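import Summits.Ventures.CertifiedManyBodySolver.Observables.PairLROOnePointTwisted
import HarnessLib

/-!
# Ventures/CertifiedManyBodySolver — Observables/PairLROOnePointTwistedTp0.lean

HONEST FRAMING: a one-point CEILING route — a ceiling never speaks to the presence of pairing; not a superconductivity
verdict; nothing in this file is a number. Cell `hubbard-obs` (D-0042), seat p1, `prover-hubbard-obs-p1-g7-0`.

`t′ = 0` VOCABULARY for the TWISTED one-point readers (W8): at a `t′ = 0` anchor the emitter may type the node with the
tree's `t′ = 0` Hamiltonian `hubbardTorus 2 L 1 U` (as rows 23–24 do); this wrapper reads such a node into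
`ObsPairLROCeilingAt 0 U n c'` in one application (`hubbardTorusTT'_zero`) for the lattice twist
(`twistedSpaceGroupUnitary`); the flip-twisted twin is the same three lines with
`ObsPairLROCeilingAt_of_onePoint_twistedFlip_orbitState_bound_sq`.
No named fact, zero computation, no `sorry`; CONDITIONAL on the claim node fed in.
References: T. Koma, H. Tasaki, J. Stat. Phys. 76 (1994) 745, Theorem 5 [KomaTasaki1994].
-/

noncomputable section

namespace Summit.Ventures.CertifiedManyBodySolver.Observables

open Matrix Complex Literature.MathematicalPhysics.QuantumLattice Literature.Probability.LatticeModels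
open Literature.MathematicalPhysics.QuantumLattice.HubbardWave0 ThermodynamicLimit Filter Topology
open Literature.MathematicalPhysics.QuantumManyBody.StateRelaxation
open Summit.Ventures.CertifiedManyBodySolver.Transport
open scoped ComplexOrder ComplexConjugate BigOperators

variable {U n : ℝ} {hi c' : ℚ} {c A κ u ν : ℝ}

/-- **`t′ = 0` vocabulary, lattice twist.** [cite: KomaTasaki1994, Theorem 5] -/
theorem ObsPairLROCeilingAt_tp0_of_onePoint_twisted_orbitState_bound_sq (hU : 0 ≤ U) (hn0 : 0 ≤ n) (hn2 : n < 2)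
    (μ : Fin 2 → ℝ) (hκ : 0 ≤ κ) (hE : energyDensityTT' 1 0 U n ≤ ((hi : ℚ) : ℝ)) (hhi : ((hi : ℚ) : ℝ) ≤ u)
    {S : Finset (DihedralGroup 4)} (hS : S.Nonempty)
    {Λ' : Finset (Site 2)} (h0 : pairRegion (insert (0 : Site 2) unitSteps) 0 ⊆ Λ') (L₁ : ℕ)
    (hInj : ∀ L : ℕ, L₁ ≤ L → Set.InjOn (Torus.proj (d := 2) L) ↑Λ')
    (hbound : ∀ (L : ℕ) [NeZero L] (hL : L₁ ≤ L) (ζ : Fock (Orb (FermionTorus 2 L))), star ζ ⬝ᵥ ζ = 1 →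
      c - A + ∑ σ : Fin 2, μ σ *
          ((star ζ ⬝ᵥ ((∑ y : FermionTorus 2 L, numberOp y σ) *ᵥ ζ)).re / (L : ℝ) ^ 2 - ν) +
        κ * (u - (star ζ ⬝ᵥ (hubbardTorus 2 L 1 U *ᵥ ζ)).re / (L : ℝ) ^ 2) ≤
        (orbitState (twistedSpaceGroupUnitary S) ζ (fermionEmbed (PolySite.toTorusEmb L (hInj L hL))
          (-(fermionEmbed (PolySite.incl h0)
            (localPairAt (insert (0 : Site 2) unitSteps) dWaveFormFactor 0))))).re)
    (hc' : (c - A + (∑ σ : Fin 2, μ σ) * (n / 2 - ν)) ^ 2 ≤ ((c' : ℚ) : ℝ)) :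
    ObsPairLROCeilingAt 0 U n c' := by
  refine ObsPairLROCeilingAt_of_onePoint_twisted_orbitState_bound_sq hU hn0 hn2 μ hκ hE hhi hS h0 L₁ hInj ?_ hc'
  intro L _ hL ζ hζ
  rw [hubbardTorusTT'_zero]
  exact hbound L hL ζ hζ

end Summit.Ventures.CertifiedManyBodySolver.Observables

end
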